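import Literature.AnabelianGeometry.SemiGraphs.ApproximatorGluedCoverings
import Mathlib.Data.Finite.Sum
import Mathlib.Data.Finite.Prod
import Mathlib.Tactic.Group
import HarnessLib

/-!
# [SemiAnbd] Theorem 3.7 (ii), distinct vertices: verticial subgroups at distinct vertices meet in
# a subgroup of infinite index

Mochizuki, *Semi-graphs of anabelioids*, Publ. RIMS **42** (2006), §3, manuscript p. 40
[cite: MochizukiSemiAnbd2006, Thm 3.7(ii) p.40]: "if `H₁`, `H₂` are verticial subgroups of
`π₁^temp(G)` that arise from distinct parametrization data, then `H₁ ∩ H₂` has infinite index in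
`H₁`".  Print: "(ii) follows from the definitions; Proposition 2.6; Corollary 2.7, (i) [cf. also
Remark 2.7.2]" in light of the injection of Proposition 3.6 (iii).  Here the case of DISTINCT
VERTICES (the first clause of the named fact `ProfiniteSemiGraph.VerticialDistinct` of
`TemperedVerticial.lean`) is proved directly in the local presentation, by the argument of the
proof of Proposition 2.6 (pp. 28–29) run in `B^temp(G)`:

* `Approximator.MixedSpec` / `MixedSpec.toGluingData` — the covering `G''` of p. 28: over a vertex
  `w`, "a union of … copies of the covering defined by the `Π'_w`-set `Π'_w/N_w` and of … copies of a
  universal covering of `G'_w`" (`mixedAction`), over the edges unions of universal coverings; it is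
  gluing data (`ApproximatorGluedCoverings.lean`) as soon as the `N_w` that occur meet no conjugate of
  a branch image `b'_*(Π'_e)` — the defining property of an ELEVATED vertex (Def. 2.4 (i)) — and the
  cardinalities match;
* `IsVerticialHom.exists_equiv` — a verticial homomorphism `ψ : Π_v → π₁^temp(G)` identifies the
  `Π_v`-set `S_v` of every tempered covering `S` with the chart image of `S` restricted along `ψ`;
* `relIndex_eq_zero_of_ne` — for `H₁ = ψ₁(Π_{v₁})`, `H₂ = ψ₂(Π_{v₂})`, `v₁ ≠ v₂`: if
  `[H₁ : H₁ ∩ H₂] = n` were finite, take (`v₁` elevated) a `π₁`-epimorphic approximator with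
  `N ⊆ Π'_{v₁}` of order `> n` meeting no conjugate of the branch images, and the covering `G''` with
  the `Π'_{v₁}/N`-part at `v₁` only.  On the chart image `X` of `G''`, `H₂` acts through the free
  `Π'_{v₂}`-set `G''_{v₂}`, so an element of `H₁ ∩ H₂` fixing a point acts trivially ("`Π''_K` acts
  freely on `S`", p. 29); the point of `X` under `1·N` has isotropy of order `≥ [N : 1] > n` in the
  image of `Π_{v₁}`, whereas that isotropy meets the image of `H₁ ∩ H₂` trivially and so has order
  `≤ [H₁ : H₁ ∩ H₂] = n` — a contradiction.  (Uses the injectivity of `ψ₁`, `verticialHom_injective`.)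
* `verticialDistinct_of_sameVertex` — the named fact REDUCED to its second clause (same vertex,
  distinct cosets; print: Cor. 2.7 (i) / Rmk. 2.7.2), which is the sequel.
-/

open CategoryTheory Topology

namespace Literature.AnabelianGeometry.SemiGraphs

universe u

/-- `K` acting on `(K/N × T) ⊕ (K × T')` by left translation on the first factors ("copies of the
covering defined by the `Π'_v`-set `Π'_v/N_M` and … copies of a universal covering", p. 28).
[folklore] -/
@[reducible] def mixedAction (K : Type*) [Group K] (N : Subgroup K) (T T' : Type*) :
    MulAction K ((K ⧸ N) × T ⊕ K × T') where
  smul k := Sum.map (fun p => (k • p.1, p.2)) (fun p => (k * p.1, p.2))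
  one_smul x := by
    rcases x with ⟨q, t⟩ | ⟨f, t⟩
    · change Sum.inl ((1 : K) • q, t) = _
      rw [one_smul]
    · change Sum.inr (1 * f, t) = _
      rw [one_mul]
  mul_smul k k' x := by
    rcases x with ⟨q, t⟩ | ⟨f, t⟩
    · change Sum.inl ((k * k') • q, t) = Sum.inl (k • k' • q, t)
      rw [mul_smul]
    · change Sum.inr (k * k' * f, t) = Sum.inr (k * (k' * f), t)
      rw [mul_assoc]

section BTempTools

variable {G : Type u} [Group G] [TopologicalSpace G]

/-- Equivariance of a morphism of `B^temp(Π)`, pointwise. [cite: MochizukiSemiAnbd2006, §3 p.33] -/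
private theorem hom_ρ_apply' {X Y : BTemp G} (f : X ⟶ Y) (g : G) (x : X.obj.V) :
    f.hom.hom (X.obj.ρ g x) = Y.obj.ρ g (f.hom.hom x) := by
  have e := ConcreteCategory.congr_hom (f.hom.comm g) x
  simp only [types_comp_apply] at e
  exact e

/-- An isomorphism `X ≅ res_φ Y` in `B^temp(Π)` is an equivariant bijection of underlying sets.
[cite: MochizukiSemiAnbd2006, §3 p.34] -/
theorem BTemp.exists_equiv_of_iso_res {H : Type u} [Group H] [TopologicalSpace H] (φ : G →ₜ* H)
    {X : BTemp G} {Y : BTemp H} (i : X ≅ (BTemp.res φ).obj Y) :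
    ∃ e : X.obj.V ≃ Y.obj.V, ∀ (g : G) (x : X.obj.V), e (X.obj.ρ g x) = Y.obj.ρ (φ g) (e x) := by
  let i' : X.obj.V ≅ Y.obj.V :=
    ((temperedAction G).ι ⋙ Action.forget (Type u) G).mapIso i
  refine ⟨i'.toEquiv, fun g x => ?_⟩
  change i.hom.hom.hom (X.obj.ρ g x) = Y.obj.ρ (φ g) (i.hom.hom.hom x)
  rw [hom_ρ_apply']
  rfl

end BTempTools

namespace ProfiniteSemiGraph

variable {𝒢 : ProfiniteSemiGraph.{u}}

/-- A verticial homomorphism `ψ : Π_v → π₁^temp(G)` identifies, for every tempered covering `S`,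
the `Π_v`-set `S_v` with the chart image of `S` restricted along `ψ` (the defining isomorphism
`B^temp(G) → G_v^⊤ ≅ B^temp(ψ)`, evaluated at `S` and composed with the unit of the chart).
[cite: MochizukiSemiAnbd2006, Thm 3.7(i) p.40] -/
theorem IsVerticialHom.exists_equiv {c : TemperedPiChart 𝒢} {v : 𝒢.graph.Vertex}
    {ψ : 𝒢.Gv v →ₜ* c.G} (hψ : IsVerticialHom c v ψ) (S : BTempCat 𝒢) :
    ∃ e : (S.obj.SV v).obj.V ≃ (c.equiv.functor.obj S).obj.V,
      ∀ (γ : 𝒢.Gv v) (s : (S.obj.SV v).obj.V),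
        e ((S.obj.SV v).obj.ρ γ s) = (c.equiv.functor.obj S).obj.ρ (ψ γ) (e s) := by
  obtain ⟨η⟩ := hψ
  exact BTemp.exists_equiv_of_iso_res ψ
    ((ObjectProperty.ι _ ⋙ restrictV 𝒢 v).mapIso (c.equiv.unitIso.app S) ≪≫
      η.app (c.equiv.functor.obj S))

namespace Approximator

variable (A : 𝒢.Approximator)

/-- Specification of the covering `G''` of the proof of Prop. 2.6 (p. 28): for every vertex `w` a
subgroup `N_w ⊆ Π'_w` and multiplicities `a_w` (copies of `Π'_w/N_w`), `a'_w` (copies of the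
universal covering of `G'_w`), for every edge a multiplicity `k_e` (copies of the universal
covering of `G'_e`), such that the `N_w` that occur meet no conjugate of a branch image (elevated
vertices, Def. 2.4 (i)) and the cardinalities along the branches match.
[cite: MochizukiSemiAnbd2006, Prop 2.6 p.28] -/
structure MixedSpec : Type u where
  /-- the subgroups `N_w ⊆ Π'_w` -/
  Nf : ∀ w : 𝒢.graph.Vertex, Subgroup (A.FV w)
  /-- number of copies of `Π'_w/N_w` -/
  a : 𝒢.graph.Vertex → ℕ
  /-- number of copies of the universal covering of `G'_w` -/
  a' : 𝒢.graph.Vertex → ℕ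
  /-- number of copies of the universal covering of `G'_e` -/
  k : 𝒢.graph.Edge → ℕ
  /-- where `Π'_w/N_w` occurs, `N_w` meets no conjugate of a branch image -/
  free : ∀ (b : 𝒢.graph.Branch) (w : 𝒢.graph.Vertex) (h : 𝒢.graph.abuts b = some w)
    (g : A.FV w), 0 < a w → Nf w ⊓ ((A.brF b w h).range.map (MulAut.conj g).toMonoidHom) = ⊥
  /-- matching cardinalities along the branches -/
  card : ∀ (b : 𝒢.graph.Branch) (w : 𝒢.graph.Vertex), 𝒢.graph.abuts b = some w →
    Nat.card (A.FE (𝒢.graph.edgeOf b)) * k (𝒢.graph.edgeOf b) =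
      (Nf w).index * a w + Nat.card (A.FV w) * a' w

namespace MixedSpec

variable {A} (σ : A.MixedSpec)

/-- The gluing data of the covering `G''` (p. 28) specified by `σ`.
[cite: MochizukiSemiAnbd2006, Prop 2.6 p.28] -/
noncomputable def toGluingData : A.GluingData where
  XV w := (A.FV w ⧸ σ.Nf w) × Fin (σ.a w) ⊕ A.FV w × Fin (σ.a' w)
  XE e := A.FE e × Fin (σ.k e)
  actV w := mixedAction (A.FV w) (σ.Nf w) (Fin (σ.a w)) (Fin (σ.a' w))
  actE e := prodLeftAction (A.FE e) (Fin (σ.k e))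
  finiteV w := by
    haveI : Finite (A.FV w ⧸ σ.Nf w) := Finite.of_surjective _ QuotientGroup.mk_surjective
    infer_instance
  finiteE e := inferInstance
  free_E e f y hy := mul_eq_right.mp (congrArg Prod.fst hy)
  free_br b w h g f x hx := by
    rcases x with ⟨q, t⟩ | ⟨f', t⟩
    · -- the `Π'_w/N_w`-part: `N_w` meets no conjugate of `b'_*(Π'_e)`
      obtain ⟨q₀, rfl⟩ := QuotientGroup.mk_surjective q
      change Sum.inl ((g * A.brF b w h f * g⁻¹) • (q₀ : A.FV w ⧸ σ.Nf w), t) =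
        Sum.inl ((q₀ : A.FV w ⧸ σ.Nf w), t) at hx
      have hq := congrArg Prod.fst (Sum.inl.inj hx)
      dsimp only at hq
      rw [MulAction.Quotient.smul_mk, smul_eq_mul, QuotientGroup.eq] at hq
      -- `hq : (g b'(f) g⁻¹ q₀)⁻¹ * q₀ ∈ N_w`
      have hN : (q₀⁻¹ * g) * A.brF b w h f * (q₀⁻¹ * g)⁻¹ ∈ σ.Nf w := by
        have := (σ.Nf w).inv_mem hq
        have e : ((g * A.brF b w h f * g⁻¹ * q₀)⁻¹ * q₀)⁻¹ =
            (q₀⁻¹ * g) * A.brF b w h f * (q₀⁻¹ * g)⁻¹ := by group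
        rwa [e] at this
      have hR : (q₀⁻¹ * g) * A.brF b w h f * (q₀⁻¹ * g)⁻¹ ∈
          ((A.brF b w h).range.map (MulAut.conj (q₀⁻¹ * g)).toMonoidHom) :=
        ⟨A.brF b w h f, ⟨f, rfl⟩, rfl⟩
      have hmem := Subgroup.mem_inf.mpr ⟨hN, hR⟩
      rw [σ.free b w h (q₀⁻¹ * g) t.pos, Subgroup.mem_bot, conj_eq_one_iff] at hmem
      apply A.brF_injective b w h
      rw [map_one]
      exact hmem
    · -- the universal part: left multiplication is free
      change Sum.inr (g * A.brF b w h f * g⁻¹ * f', t) = Sum.inr (f', t) at hx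
      have h1 := congrArg Prod.fst (Sum.inr.inj hx)
      dsimp only at h1
      apply A.brF_injective b w h
      rw [map_one]
      exact conj_eq_one_iff.mp (mul_eq_right.mp h1)
  card_br b w h := by
    haveI : Finite (A.FV w ⧸ σ.Nf w) := Finite.of_surjective _ QuotientGroup.mk_surjective
    rw [Nat.card_prod, Nat.card_sum, Nat.card_prod, Nat.card_prod]
    simp only [Nat.card_eq_fintype_card (α := Fin _), Fintype.card_fin]
    rw [← Subgroup.index]
    exact σ.card b w h

/-- The `w`-constituent of `G''`, unfolded. [cite: MochizukiSemiAnbd2006, Prop 2.6 p.28] -/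
theorem ρ_inl (w : 𝒢.graph.Vertex) (γ : 𝒢.Gv w) (q : A.FV w ⧸ σ.Nf w) (t : Fin (σ.a w)) :
    (σ.toGluingData.tcov.obj.SV w).obj.ρ γ (Sum.inl (q, t)) =
      (Sum.inl (A.πV w γ • q, t) : (A.FV w ⧸ σ.Nf w) × Fin (σ.a w) ⊕ A.FV w × Fin (σ.a' w)) :=
  rfl

/-- The `w`-constituent of `G''`, unfolded (universal part). [cite: MochizukiSemiAnbd2006, Prop 2.6 p.28] -/
theorem ρ_inr (w : 𝒢.graph.Vertex) (γ : 𝒢.Gv w) (f : A.FV w) (t : Fin (σ.a' w)) :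
    (σ.toGluingData.tcov.obj.SV w).obj.ρ γ (Sum.inr (f, t)) =
      (Sum.inr (A.πV w γ * f, t) : (A.FV w ⧸ σ.Nf w) × Fin (σ.a w) ⊕ A.FV w × Fin (σ.a' w)) :=
  rfl

end MixedSpec

end Approximator

/-! ### Theorem 3.7 (ii), distinct vertices -/

/-- **Theorem 3.7 (ii), distinct vertices** ([SemiAnbd] p. 40; the argument of the proof of
Proposition 2.6, pp. 28–29, run in `B^temp(G)`): for `G` as in Proposition 3.6 (only "totally
elevated" and the boundedness of approximators are used), verticial subgroups `H₁`, `H₂` of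
`π₁^temp(G)` attached to DISTINCT vertices `v₁ ≠ v₂` satisfy `[H₁ : H₁ ∩ H₂] = ∞`. [cite: MochizukiSemiAnbd2006, Thm 3.7(ii) p.40] -/
theorem relIndex_eq_zero_of_ne (h𝒢 : 𝒢.Prop36Hypotheses) (c : TemperedPiChart 𝒢)
    {v₁ v₂ : 𝒢.graph.Vertex} (hne : v₁ ≠ v₂) {H₁ H₂ : Subgroup c.G}
    (hH₁ : H₁ ∈ verticialSubgroups c v₁) (hH₂ : H₂ ∈ verticialSubgroups c v₂) :
    H₂.relIndex H₁ = 0 := by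
  classical
  obtain ⟨ψ₁, hψ₁, rfl⟩ := hH₁
  obtain ⟨ψ₂, hψ₂, rfl⟩ := hH₂
  by_contra hn
  -- `K₀ = ψ₁⁻¹(H₂) ⊆ Π_{v₁}`, of finite index `[H₁ : H₁ ∩ H₂]` (`ψ₁` is injective, but only
  -- `index_comap` is needed here)
  set K₀ : Subgroup (𝒢.Gv v₁) := (ψ₂.toMonoidHom.range).comap ψ₁.toMonoidHom with hK₀def
  have hK₀ : K₀.index = ψ₂.toMonoidHom.range.relIndex ψ₁.toMonoidHom.range :=
    Subgroup.index_comap _ _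
  have hK₀ne : K₀.index ≠ 0 := hK₀ ▸ hn
  -- `v₁` is elevated: a `π₁`-epimorphic approximator with `N ⊆ Π'_{v₁}` of order `> [Π_{v₁} : K₀]`
  -- meeting no conjugate of a branch image
  obtain ⟨A, hAepi, N, hMN, hNfree⟩ := h𝒢.isTotallyElevated v₁ (K₀.index + 1)
  obtain ⟨M₀, hM₀, hdvd⟩ := A.bounded
  have hNdvd : N.index ∣ M₀ := (Subgroup.index_dvd_card (H := N)).trans (hdvd v₁)
  -- the covering `G''` of p. 28: `Π'_{v₁}/N`-part at `v₁` only, universal parts everywhere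
  let Nf : ∀ w : 𝒢.graph.Vertex, Subgroup (A.FV w) :=
    Function.update (fun w => (⊤ : Subgroup (A.FV w))) v₁ N
  have hNf₁ : Nf v₁ = N := by
    simp only [Nf, Function.update_self]
  let a : 𝒢.graph.Vertex → ℕ := fun w => if w = v₁ then M₀ / N.index else 0
  let a' : 𝒢.graph.Vertex → ℕ := fun w =>
    if w = v₁ then M₀ / Nat.card (A.FV w) else 2 * M₀ / Nat.card (A.FV w)
  let k : 𝒢.graph.Edge → ℕ := fun e => 2 * M₀ / Nat.card (A.FE e)
  have ha : ∀ w, w ≠ v₁ → a w = 0 := fun w hw => if_neg hw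
  have ha₁ : a v₁ = M₀ / N.index := if_pos rfl
  have ha'₁ : a' v₁ = M₀ / Nat.card (A.FV v₁) := if_pos rfl
  have ha' : ∀ w, w ≠ v₁ → a' w = 2 * M₀ / Nat.card (A.FV w) := fun w hw => if_neg hw
  have ha₁pos : 0 < a v₁ := by
    rw [ha₁]
    exact Nat.div_pos (Nat.le_of_dvd hM₀ hNdvd) Nat.card_pos
  have ha'₁pos : 0 < a' v₁ := by
    rw [ha'₁]
    exact Nat.div_pos (Nat.le_of_dvd hM₀ (hdvd v₁)) Nat.card_pos
  have hfree : ∀ (b : 𝒢.graph.Branch) (w : 𝒢.graph.Vertex) (h : 𝒢.graph.abuts b = some w)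
      (g : A.FV w), 0 < a w →
      Nf w ⊓ ((A.brF b w h).range.map (MulAut.conj g).toMonoidHom) = ⊥ := by
    intro b w h g haw
    have hw : w = v₁ := by
      by_contra hw
      rw [ha w hw] at haw
      exact lt_irrefl 0 haw
    subst hw
    rw [hNf₁]
    exact hNfree b h g
  have hcard : ∀ (b : 𝒢.graph.Branch) (w : 𝒢.graph.Vertex), 𝒢.graph.abuts b = some w →
      Nat.card (A.FE (𝒢.graph.edgeOf b)) * k (𝒢.graph.edgeOf b) =
        (Nf w).index * a w + Nat.card (A.FV w) * a' w := by
    intro b w h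
    have hE : Nat.card (A.FE (𝒢.graph.edgeOf b)) ∣ 2 * M₀ :=
      ((Subgroup.card_dvd_of_injective _ (A.brF_injective b w h)).trans (hdvd w)).trans
        (dvd_mul_left M₀ 2)
    have lhs : Nat.card (A.FE (𝒢.graph.edgeOf b)) * k (𝒢.graph.edgeOf b) = 2 * M₀ :=
      Nat.mul_div_cancel' hE
    rw [lhs]
    by_cases hw : w = v₁
    · subst hw
      rw [hNf₁, ha₁, ha'₁, Nat.mul_div_cancel' hNdvd, Nat.mul_div_cancel' (hdvd _), two_mul]
    · rw [ha w hw, ha' w hw, mul_zero, zero_add,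
        Nat.mul_div_cancel' ((hdvd w).trans (dvd_mul_left M₀ 2))]
  let σ : A.MixedSpec := ⟨Nf, a, a', k, hfree, hcard⟩
  let S : BTempCat 𝒢 := σ.toGluingData.tcov
  -- the chart image `X` of `G''` and the identifications `S_{v_i} ≃ ψ_i^* X`
  obtain ⟨e₁, he₁⟩ := IsVerticialHom.exists_equiv hψ₁ S
  obtain ⟨e₂, he₂⟩ := IsVerticialHom.exists_equiv hψ₂ S
  -- the two test points of `S_{v₁}`: `1·N` in the quotient part, `1` in a universal copy
  let p₀ : (A.FV v₁ ⧸ Nf v₁) × Fin (a v₁) ⊕ A.FV v₁ × Fin (a' v₁) :=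
    Sum.inl (((1 : A.FV v₁) : A.FV v₁ ⧸ Nf v₁), ⟨0, ha₁pos⟩)
  let p₁ : (A.FV v₁ ⧸ Nf v₁) × Fin (a v₁) ⊕ A.FV v₁ × Fin (a' v₁) :=
    Sum.inr ((1 : A.FV v₁), ⟨0, ha'₁pos⟩)
  -- KEY ("`Π''_K` acts freely on `S`", p. 29): an element of `K₀` whose image lies in `N` has
  -- trivial image in `Π'_{v₁}`
  have key : ∀ γ : 𝒢.Gv v₁, γ ∈ K₀ → A.πV v₁ γ ∈ Nf v₁ → A.πV v₁ γ = 1 := by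
    intro γ hγK hγN
    obtain ⟨δ, hδ⟩ := MonoidHom.mem_range.mp (Subgroup.mem_comap.mp hγK)
    change ψ₂ δ = ψ₁ γ at hδ
    -- `γ` fixes `p₀`
    have h1 : (S.obj.SV v₁).obj.ρ γ p₀ = p₀ := by
      change Sum.inl (A.πV v₁ γ • ((1 : A.FV v₁) : A.FV v₁ ⧸ Nf v₁), (⟨0, ha₁pos⟩ : Fin (a v₁))) =
        Sum.inl (((1 : A.FV v₁) : A.FV v₁ ⧸ Nf v₁), ⟨0, ha₁pos⟩)
      rw [MulAction.Quotient.smul_mk, smul_eq_mul, mul_one]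
      congr 2
      rw [QuotientGroup.eq, mul_one]
      exact (Nf v₁).inv_mem hγN
    -- hence `ψ₁ γ = ψ₂ δ` fixes `e₁ p₀`, so `δ` fixes the corresponding point of `S_{v₂}`
    have h2 : (c.equiv.functor.obj S).obj.ρ (ψ₂ δ) (e₁ p₀) = e₁ p₀ := by
      rw [hδ, ← he₁, h1]
    have h3 : (S.obj.SV v₂).obj.ρ δ (e₂.symm (e₁ p₀)) = e₂.symm (e₁ p₀) := by
      apply e₂.injective
      rw [he₂, Equiv.apply_symm_apply, h2]
    -- `S_{v₂}` is a union of universal copies (`a v₂ = 0`): `δ ↦ 1` in `Π'_{v₂}`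
    have h4 : A.πV v₂ δ = 1 := by
      set t := e₂.symm (e₁ p₀) with ht
      clear_value t
      change (A.FV v₂ ⧸ Nf v₂) × Fin (a v₂) ⊕ A.FV v₂ × Fin (a' v₂) at t
      rcases t with ⟨q, i⟩ | ⟨f, i⟩
      · have hi : (i : ℕ) < a v₂ := i.isLt
        have h0 := ha v₂ (Ne.symm hne)
        omega
      · change Sum.inr (A.πV v₂ δ * f, i) = Sum.inr (f, i) at h3
        exact mul_eq_right.mp (congrArg Prod.fst (Sum.inr.inj h3))
    -- so `ψ₂ δ` acts trivially on `X`
    have h5 : ∀ x : (c.equiv.functor.obj S).obj.V,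
        (c.equiv.functor.obj S).obj.ρ (ψ₂ δ) x = x := by
      intro x
      obtain ⟨t, rfl⟩ := e₂.surjective x
      rw [← he₂]
      congr 1
      change (A.FV v₂ ⧸ Nf v₂) × Fin (a v₂) ⊕ A.FV v₂ × Fin (a' v₂) at t
      rcases t with ⟨q, i⟩ | ⟨f, i⟩
      · change Sum.inl (A.πV v₂ δ • q, i) = Sum.inl (q, i)
        rw [h4, one_smul]
      · change Sum.inr (A.πV v₂ δ * f, i) = Sum.inr (f, i)
        rw [h4, one_mul]
    -- hence `γ` acts trivially on `S_{v₁}`; test on the universal point `p₁`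
    have h6 : (S.obj.SV v₁).obj.ρ γ p₁ = p₁ := by
      apply e₁.injective
      rw [he₁, ← hδ, h5]
    change Sum.inr (A.πV v₁ γ * 1, (⟨0, ha'₁pos⟩ : Fin (a' v₁))) = Sum.inr (1, ⟨0, ha'₁pos⟩) at h6
    have h7 := congrArg Prod.fst (Sum.inr.inj h6)
    rwa [mul_one] at h7
  -- COUNTING in `Π_{v₁}`: `I₀ = π⁻¹(N)` (isotropy of `p₀`), `L₀ = Ker π`
  let π : 𝒢.Gv v₁ →* A.FV v₁ := A.πV v₁
  let I₀ : Subgroup (𝒢.Gv v₁) := (Nf v₁).comap π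
  let L₀ : Subgroup (𝒢.Gv v₁) := π.ker
  have hKI : K₀ ⊓ I₀ ≤ L₀ := fun γ hγ =>
    (MonoidHom.mem_ker).mpr (key γ hγ.1 (Subgroup.mem_comap.mp hγ.2))
  have hsurj : Function.Surjective π := hAepi.1 v₁
  -- `[I₀ : L₀] = [N : 1]`
  have hNcard : L₀.relIndex I₀ = Nat.card N := by
    have hL : L₀ = (⊥ : Subgroup (A.FV v₁)).comap π := (MonoidHom.comap_bot π).symm
    rw [hL, Subgroup.relIndex_comap, Subgroup.map_comap_eq_self_of_surjective hsurj,
      Subgroup.relIndex_bot_left, hNf₁]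
  -- `[I₀ : K₀ ∩ I₀] ≤ [Π_{v₁} : K₀]`, finite
  have h9 : K₀.relIndex I₀ ≤ K₀.index := by
    rw [← Subgroup.relIndex_top_right]
    exact Subgroup.relIndex_le_of_le_right le_top (by rwa [Subgroup.relIndex_top_right])
  have hfin : K₀.relIndex I₀ ≠ 0 := fun h0 =>
    hK₀ne (by
      rw [← Subgroup.relIndex_top_right]
      exact Subgroup.relIndex_eq_zero_of_le_right le_top h0)
  have h8 : (K₀ ⊓ I₀).relIndex I₀ = K₀.relIndex I₀ := Subgroup.inf_relIndex_right _ _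
  -- `[I₀ : L₀] ≤ [I₀ : K₀ ∩ I₀]` since `K₀ ∩ I₀ ⊆ L₀`
  have h7 : L₀.relIndex I₀ ≤ (K₀ ⊓ I₀).relIndex I₀ :=
    Subgroup.relIndex_le_of_le_left hKI (by rwa [h8])
  -- `[N : 1] ≥ K₀.index + 1`: contradiction
  rw [hNcard, h8] at h7
  omega

/-- **Theorem 3.7 (ii)** as typed (`VerticialDistinct`), REDUCED to its second clause (same
vertex, distinct cosets `g₁ π̂₁(G_v) ≠ g₂ π̂₁(G_v)`; print: Cor. 2.7 (i) / Rmk. 2.7.2): the first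
clause (distinct vertices) is `relIndex_eq_zero_of_ne`. [cite: MochizukiSemiAnbd2006, Thm 3.7(ii) p.40] -/
theorem verticialDistinct_iff_sameVertex :
    VerticialDistinct.{u} ↔
      ∀ (𝒢 : ProfiniteSemiGraph.{u}), 𝒢.Thm37Hypotheses → ∀ (c : TemperedPiChart 𝒢)
        (v : 𝒢.graph.Vertex) (H : Subgroup c.G), H ∈ verticialSubgroups c v →
        ∀ g₁ g₂ : c.G, g₁⁻¹ * g₂ ∉ H →
          (H.map (MulAut.conj g₂).toMonoidHom).relIndex (H.map (MulAut.conj g₁).toMonoidHom) = 0 :=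
  ⟨fun h 𝒢 h𝒢 c => (h 𝒢 h𝒢 c).2, fun h 𝒢 h𝒢 c =>
    ⟨fun _ _ _ _ hH₁ hH₂ hne => relIndex_eq_zero_of_ne h𝒢.toProp36Hypotheses c hne hH₁ hH₂,
      h 𝒢 h𝒢 c⟩⟩

end ProfiniteSemiGraph

end Literature.AnabelianGeometry.SemiGraphs
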